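import Mathlib
import Literature.Analysis.FluidPDE.Tao2016AveragedNS.ShiftSetCascadeFlows
import Summits.NavierStokesRegularity.NavierStokesRegularity.Theorems.TaoLadderRungTwoFlatCertificateGlueMeshOn
import HarnessLib

/-!
# Certificate glue on a shift set `𝕊`, X-c: BRANCHWISE DYNAMIC READOUT — the trapping and landing clauses of
  the A♭ window certificate from PER-BRANCH statements about window runs (no mesh, no static section box)
  (helper for item stmt-NavierStokesRegularity-22987 `FlatGapCertificatesV2` and stmt-24295 K_A₂(64);
  cell harvest/h2-tao-ladder, p1 g14; shape requested by theory-1 g21, ruling T-34)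

A validated integrator run from a start BOX `b` (one per branch of the core: datum box, transit boxes,
recurrent box) naturally certifies, for EVERY window run from that box (every realisation of the two edge
inputs): (i) rough enclosures `Hull b` valid at every time up to the clock `c`; (ii) the SIGN of a section
functional at two times `tlo b < thi b ≤ c₀` (`sec < lev` at `tlo b`, `lev ≤ sec` at `thi b`); (iii) the static
readout clauses at every state reached at a time `s ∈ [tlo b, thi b]` ON the section `{sec = lev}`. This module
turns exactly these branchwise statements into the clauses of glue IV:

* `htrap_of_branches` — (i) + hulls inside the open `M`-box + a cover of the fattened core by the boxes ⇒ `htrap`;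
* `hland_of_branches` — (ii) + (iii) + the cover + continuity of `sec` along runs ⇒ `hland` (intermediate value
  theorem on the given run between `tlo b` and `thi b`; `τ₁` per trajectory).

Compared with glue X/X-b (mesh + static readout on `Hull ℓ ∩ {sec = lev}`) nothing is evaluated on a box slab
around the section: the readout is required only at states actually reached on the section, which is what a
parametrised image enclosure delivers (theory-1 T-34 (β)).

HONEST FRAMING: Tao-type MODEL lattices (Tao 2016 §4/§6 vocabulary, shift-set parametrised); the branch data are
HYPOTHESES — nothing is computed or certified here, no stub is closed, nothing about the Navier–Stokes equations.
-/

noncomputable section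

-- the sub-problem namespace repeats the summit name by design (D-0017)
set_option linter.dupNamespace false

namespace Summit.NavierStokesRegularity.NavierStokesRegularity.Theorems

open Set Filter Topology Literature.Analysis.FluidPDE Literature.Analysis.FluidPDE.TaoCascade

namespace CertificateGlueOn

variable {m : ℕ} {ι : Type*} {𝕊 : Finset (ℤ × ℤ × ℤ)} {ε₀ : ℝ} {α : Fin m → Fin m → Fin m → ℤ × ℤ × ℤ → ℝ}
  {Kb Ka : ℤ} {Eb Et : ℝ} {M : ℤ → ℝ} {Core : (Fin m → ℤ → ℝ) → Prop} {w : ℤ → ℝ} {r : ℝ}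
  {Box Hull : ι → (Fin m → ℤ → ℝ) → Prop}

/-- **THE TRAPPING CLAUSE `htrap` FROM BRANCHWISE ROUGH ENCLOSURES**: the fattened core is covered by the start
boxes `Box b`; every window run of length `≤ c` from `Box b` (a priori in the closed `M`-box) stays in `Hull b`;
every `Hull b` lies in the OPEN `M`-box ⇒ the clause `htrap` of glue IV verbatim (edge bounds `Eb`, `Et`).
[cite: Tao2016AveragedNS, §6.3–6.4 Props. 6.4–6.5 (statement shape of a renormalisation certificate); cell certificate format, branch layer] -/
theorem htrap_of_branches {c : ℝ}
    (hcover : ∀ (z S₀ : Fin m → ℤ → ℝ), Core z →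
      (∀ i k, -Kb ≤ k → k ≤ Ka → w k * |S₀ i k - z i k| ≤ r) → ∃ b, Box b S₀)
    (henc : ∀ (b : ι) (s : ℝ) (S : Fin m → ℤ → ℝ → ℝ), 0 < s → s ≤ c → Box b (slice S 0) →
      WindowRun 𝕊 ε₀ α Kb Ka Eb Et s S → (∀ i k, -Kb ≤ k → k ≤ Ka → ∀ u ∈ Icc 0 s, |S i k u| ≤ M k) →
        ∀ u ∈ Icc 0 s, Hull b (slice S u))
    (hhull : ∀ b y, Hull b y → ∀ i k, -Kb ≤ k → k ≤ Ka → |y i k| < M k) :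
    ∀ (s : ℝ) (z : Fin m → ℤ → ℝ) (S : Fin m → ℤ → ℝ → ℝ), Core z → 0 < s → s ≤ c →
      (∀ i k, -Kb ≤ k → k ≤ Ka → w k * |S i k 0 - z i k| ≤ r) →
      (∀ i k, -Kb ≤ k → k ≤ Ka → ∀ u ∈ Icc 0 s,
        HasDerivWithinAt (S i k) (quadTermOn 𝕊 ε₀ α S i k u) (Icc 0 s) u) →
      (∀ i, ContinuousOn (S i (-Kb - 1)) (Icc 0 s)) → (∀ i, ContinuousOn (S i (Ka + 1)) (Icc 0 s)) →
      (∀ i, ∀ u ∈ Icc 0 s, |S i (-Kb - 1) u| ≤ Eb) →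
      (∀ i, ∀ u ∈ Icc 0 s, |S i (Ka + 1) u| ≤ Et) →
      (∀ i k, -Kb ≤ k → k ≤ Ka → ∀ u ∈ Icc 0 s, |S i k u| ≤ M k) →
        ∀ i k, -Kb ≤ k → k ≤ Ka → ∀ u ∈ Icc 0 s, |S i k u| < M k := by
  intro s z S hz hs hsc hball hder hcb hct hbb hbt hM i k hk1 hk2 u hu
  obtain ⟨b, hb⟩ := hcover z (slice S 0) hz (by simpa [slice] using hball)
  exact hhull b _ (henc b s S hs hsc hb ⟨hder, hcb, hct, hbb, hbt⟩ hM u hu) i k hk1 hk2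

/-- **THE LANDING CLAUSE `hland` FROM BRANCHWISE DYNAMIC READOUTS**: cover of the fattened core by the boxes
`Box b`; per branch a time window `0 < tlo b ≤ thi b ≤ c₀`; a section functional continuous along runs; for every
run from `Box b` (a priori in the closed `M`-box): `sec < lev` at time `tlo b`, `lev ≤ sec` at time `thi b`, and
the STATIC READOUT at every state reached at a time `s ∈ [tlo b, thi b]` on the section `{sec = lev}` ⇒ the clause
`hland` of glue IV verbatim (edge bounds `Eb`, `Et`, exit factor `Zx`). The landing time is chosen per trajectory by
the intermediate value theorem. [cite: Tao2016AveragedNS, §6.3–6.4 Props. 6.4–6.5 (statement shape of a renormalisation certificate; the readout at the crossing); cell certificate format, branch layer] -/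
theorem hland_of_branches {ρ θ₀ σ c₀ Zx : ℝ} {i₀ : Fin m} {sec : (Fin m → ℤ → ℝ) → ℝ} {lev : ℝ}
    {tlo thi : ι → ℝ}
    (hcover : ∀ (z S₀ : Fin m → ℤ → ℝ), Core z →
      (∀ i k, -Kb ≤ k → k ≤ Ka → w k * |S₀ i k - z i k| ≤ r) → ∃ b, Box b S₀)
    (hwin : ∀ b, 0 < tlo b ∧ tlo b ≤ thi b ∧ thi b ≤ c₀)
    (hsec : ∀ (s : ℝ) (S : Fin m → ℤ → ℝ → ℝ), WindowRun 𝕊 ε₀ α Kb Ka Eb Et s S →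
      ContinuousOn (fun u => sec (slice S u)) (Icc 0 s))
    (hbefore : ∀ (b : ι) (S : Fin m → ℤ → ℝ → ℝ), Box b (slice S 0) →
      WindowRun 𝕊 ε₀ α Kb Ka Eb Et (tlo b) S →
      (∀ i k, -Kb ≤ k → k ≤ Ka → ∀ u ∈ Icc 0 (tlo b), |S i k u| ≤ M k) → sec (slice S (tlo b)) < lev)
    (hafter : ∀ (b : ι) (S : Fin m → ℤ → ℝ → ℝ), Box b (slice S 0) →
      WindowRun 𝕊 ε₀ α Kb Ka Eb Et (thi b) S →
      (∀ i k, -Kb ≤ k → k ≤ Ka → ∀ u ∈ Icc 0 (thi b), |S i k u| ≤ M k) → lev ≤ sec (slice S (thi b)))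
    (hread : ∀ (b : ι) (s : ℝ) (S : Fin m → ℤ → ℝ → ℝ), tlo b ≤ s → s ≤ thi b → Box b (slice S 0) →
      WindowRun 𝕊 ε₀ α Kb Ka Eb Et s S →
      (∀ i k, -Kb ≤ k → k ≤ Ka → ∀ u ∈ Icc 0 s, |S i k u| ≤ M k) → sec (slice S s) = lev →
      ∃ (a : ℝ) (z' : Fin m → ℤ → ℝ), 0 < a ∧ (1 + ε₀) ^ (-θ₀) ≤ a ∧ (1 + σ) * a ≤ |S i₀ 1 s| ∧ Core z' ∧
        (∀ i k, -Kb ≤ k → k + 1 ≤ Ka → w k * |S i (1 + k) s / a - z' i k| ≤ ρ * r) ∧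
        (∀ (i : Fin m) (v : ℝ), |v| ≤ Et → w Ka * |v / a - z' i Ka| ≤ ρ * r) ∧
        (∀ i, |S i (-Kb) s| ≤ a * Zx)) :
    ∀ (z : Fin m → ℤ → ℝ) (S : Fin m → ℤ → ℝ → ℝ), Core z →
      (∀ i k, -Kb ≤ k → k ≤ Ka → w k * |S i k 0 - z i k| ≤ r) →
      (∀ i k, -Kb ≤ k → k ≤ Ka → ∀ u ∈ Icc 0 c₀,
        HasDerivWithinAt (S i k) (quadTermOn 𝕊 ε₀ α S i k u) (Icc 0 c₀) u) →
      (∀ i, ContinuousOn (S i (-Kb - 1)) (Icc 0 c₀)) → (∀ i, ContinuousOn (S i (Ka + 1)) (Icc 0 c₀)) →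
      (∀ i, ∀ u ∈ Icc 0 c₀, |S i (-Kb - 1) u| ≤ Eb) →
      (∀ i, ∀ u ∈ Icc 0 c₀, |S i (Ka + 1) u| ≤ Et) →
      (∀ i k, -Kb ≤ k → k ≤ Ka → ∀ u ∈ Icc 0 c₀, |S i k u| ≤ M k) →
        ∃ (τ₁ a : ℝ) (z' : Fin m → ℤ → ℝ), 0 < τ₁ ∧ τ₁ ≤ c₀ ∧ 0 < a ∧ (1 + ε₀) ^ (-θ₀) ≤ a ∧
          (1 + σ) * a ≤ |S i₀ 1 τ₁| ∧ Core z' ∧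
          (∀ i k, -Kb ≤ k → k + 1 ≤ Ka → w k * |S i (1 + k) τ₁ / a - z' i k| ≤ ρ * r) ∧
          (∀ (i : Fin m) (v : ℝ), |v| ≤ Et → w Ka * |v / a - z' i Ka| ≤ ρ * r) ∧
          (∀ i, |S i (-Kb) τ₁| ≤ a * Zx) := by
  intro z S hz hball hder hcb hct hbb hbt hM
  have hrun : WindowRun 𝕊 ε₀ α Kb Ka Eb Et c₀ S := ⟨hder, hcb, hct, hbb, hbt⟩
  obtain ⟨b, hb⟩ := hcover z (slice S 0) hz (by simpa [slice] using hball)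
  obtain ⟨hlo0, hlohi, hhic⟩ := hwin b
  have hMres : ∀ s', s' ≤ c₀ → ∀ i k, -Kb ≤ k → k ≤ Ka → ∀ u ∈ Icc 0 s', |S i k u| ≤ M k :=
    fun s' hs' i k hk1 hk2 u hu => hM i k hk1 hk2 u ⟨hu.1, hu.2.trans hs'⟩
  have h1 : sec (slice S (tlo b)) < lev :=
    hbefore b S hb (hrun.mono (hlohi.trans hhic)) (hMres _ (hlohi.trans hhic))
  have h2 : lev ≤ sec (slice S (thi b)) := hafter b S hb (hrun.mono hhic) (hMres _ hhic)
  -- intermediate value theorem on `[tlo b, thi b]`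
  have hcont : ContinuousOn (fun u => sec (slice S u)) (Icc (tlo b) (thi b)) :=
    (hsec c₀ S hrun).mono (Icc_subset_Icc hlo0.le hhic)
  obtain ⟨τ₁, hτ₁, hτ₁lev⟩ := intermediate_value_Icc hlohi hcont ⟨h1.le, h2⟩
  obtain ⟨a, z', ha, haθ, haσ, hz', hmatch, htop, hexit⟩ :=
    hread b τ₁ S hτ₁.1 hτ₁.2 hb (hrun.mono (hτ₁.2.trans hhic)) (hMres _ (hτ₁.2.trans hhic)) hτ₁lev
  exact ⟨τ₁, a, z', lt_of_lt_of_le hlo0 hτ₁.1, hτ₁.2.trans hhic, ha, haθ, haσ, hz', hmatch, htop, hexit⟩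

end CertificateGlueOn

end Summit.NavierStokesRegularity.NavierStokesRegularity.Theorems

end
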